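import Literature.Geometry.Riemannian.MetricFlowConcentration
import Mathlib.MeasureTheory.Measure.OpenPos
import Mathlib.Topology.MetricSpace.Isometry
import HarnessLib

/-!
# Metric flow pairs, correspondences and the `𝔽`-distance (Bamler 2023, §5.1)

R. Bamler, *Compactness theory of the space of super Ricci flows*, Invent. Math. 233 (2023), §5.1
(`I ⊂ ℝ` an interval). Definition (metric flow pairs): "A pair `(𝒳, (μ_t)_{t ∈ I'})` is called a
metric flow pair over `I ⊂ ℝ` if: (1) `I' ⊂ I` with `|I ∖ I'| = 0`. (2) `𝒳` is a metric flow over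
`I'`. (3) `(μ_t)_{t ∈ I'}` is a conjugate heat flow on `𝒳` with `supp μ_t = 𝒳_t` for all `t ∈ I'`. If
`J ⊂ I'`, then we say that `(𝒳, (μ_t))` is fully defined over `J`." Definition (Correspondence):
"Let `𝒳^i` be metric flows over `I'^{,i} ⊂ ℝ`, indexed by some `i ∈ ℐ`. A correspondence between
these metric flows over some subset `I'' ⊂ ℝ` is a pair
`ℭ := ((Z_t, d^Z_t)_{t ∈ I''}, (φ^i_t)_{t ∈ I''^{,i}, i ∈ ℐ})`, where: (1) `(Z_t, d^Z_t)` is a metric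
space for any `t ∈ I''`. (2) `I''^{,i} ⊂ I'^{,i} ∩ I''` for any `i ∈ ℐ`. (3)
`φ^i_t : (𝒳^i_t, d^i_t) → (Z_t, d^Z_t)` is an isometric embedding for any `i ∈ ℐ` and `t ∈ I''^{,i}`.
If `J ⊂ I''^{,i}` for all `i ∈ ℐ`, then we say that `ℭ` is fully defined over `J`." Definition
(`𝔽`-distance within correspondence): "the infimum over all `r > 0` with the property that there
is a measurable subset `E ⊂ I''` with `J ⊂ I'' ∖ E ⊂ I''^{,1} ∩ I''^{,2}` and a family of couplings
`(q_t)_{t ∈ I'' ∖ E}` between `μ¹_t, μ²_t` such that: (1) `|E| ≤ r²`. (2) For all `s, t ∈ I'' ∖ E`,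
`s ≤ t`, we have `∫_{𝒳¹_t × 𝒳²_t} d_{W₁}^{Z_s}((φ¹_s)_* ν¹_{x¹;s}, (φ²_s)_* ν²_{x²;s}) dq_t(x¹, x²) ≤ r`."
Definition (`𝔽`-distance): "the infimum of `d_𝔽^{ℭ,J}(…)` over all correspondences `ℭ` between
`𝒳¹, 𝒳²` over `I` that are fully defined over `J`" ("we allow `d_𝔽^{ℭ,J}` to attain the value `∞`").

This file vendors these DEFINITIONS over `MetricFlow.lean` / `MetricFlowConcentration.lean`
(`MetricFlow`, `IsConjugateHeatFlow`, `condKernel`, `IsCoupling`, `wassersteinW1`):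

* `MetricFlowPair I` — the structure of a metric flow pair over `I` (`I'`, `|I ∖ I'| = 0` for
  Lebesgue measure, the flow over `I'`, the conjugate heat flow `μ` with full support expressed as
  `Measure.IsOpenPosMeasure`); `MetricFlowPair.FullyDefinedOver`;
* `MetricFlow.Correspondence₂ 𝒳¹ 𝒳² I''` — a correspondence between TWO metric flows over `I''`
  (comparison spaces `Z t` with metric and Borel structures, domains `dom₁, dom₂ ⊆ I'^{,i} ∩ I''`,
  isometric embeddings `φ₁, φ₂`); `Correspondence₂.FullyDefinedOver`;
* `MetricFlowPair.fDistWithin ℭ J P¹ P²` — **`d_𝔽^{ℭ,J}`** (valued in `ℝ≥0∞`, an infimum of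
  `ENNReal.ofReal r` over admissible `r > 0`; pushforwards `Measure.map`, `d_{W₁}` = `wassersteinW1`
  on `Z_s`, the outer integral a lower Lebesgue integral against the coupling `q_t`);
* `MetricFlowPair.fDist J P¹ P²` — **`d_𝔽^J`**, the infimum over correspondences over `I` fully
  defined over `J` (comparison spaces ranging over a fixed universe); `fDist_le_fDistWithin`.

Design notes. The source's correspondences are indexed by an arbitrary family `ℐ` of flows (used for
the convergence of sequences in §6); the distance only involves two flows, and this file defines the
two-flow case (`-- TODO(general form)` below). Comparison spaces carry a measurable structure equal to
the Borel σ-algebra of `d^Z_t` (implicit in the source, which pushes measures forward to `Z_t`).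
What is NOT here: the spaces `𝔽_I^J`, `𝔽_I^*` of isometry classes, almost-always isometries and the
invariance Lemma, the metric-space Theorem of §5.2, completeness (§5.3), and everything after.
-- TODO(general form): correspondences between families `(𝒳^i)_{i ∈ ℐ}` of metric flows (§5.1,
-- Definition (Correspondence)) and convergence within a correspondence (§6.1).

## References

* R. H. Bamler, *Compactness theory of the space of super Ricci flows*, Invent. Math. 233 (2023),
  1121–1277 (arXiv:2008.09298), §5.1: Definitions (metric flow pairs and isometries),
  (Correspondence), (`𝔽`-distance within correspondence), (`𝔽`-distance). [Bamler2023]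
-/

noncomputable section

open Set MeasureTheory Filter TopologicalSpace Function
open scoped Topology ENNReal NNReal

namespace Literature.Geometry.Riemannian

universe u

/-! ### Metric flow pairs -/

/-- **Metric flow pair over `I`** (Bamler 2023, §5.1, Definition (metric flow pairs)): a subset
`I' ⊆ I` of full Lebesgue measure (`|I ∖ I'| = 0`), a metric flow `𝒳` over `I'`, and a conjugate heat
flow `(μ_t)_{t ∈ I'}` on `𝒳` with `supp μ_t = 𝒳_t` for all `t ∈ I'` (every nonempty open subset of
`𝒳_t` has positive `μ_t`-measure, `Measure.IsOpenPosMeasure`).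
[cite: Bamler2023, §5.1, Definition (metric flow pairs and isometries)] -/
structure MetricFlowPair (I : Set ℝ) : Type (u + 1) where
  /-- The subset `I' ⊆ I` of times at which the pair is defined. -/
  I' : Set ℝ
  /-- `I' ⊆ I`. -/
  subset : I' ⊆ I
  /-- `|I ∖ I'| = 0`. -/
  volume_diff : volume (I \ I') = 0
  /-- The metric flow over `I'`. -/
  flow : MetricFlow.{u} I'
  /-- The conjugate heat flow `(μ_t)_{t ∈ I'}`. -/
  μ : ∀ t : I', Measure (flow.Slice t)
  /-- `μ` is a conjugate heat flow over all of `I'`. -/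
  isConjugateHeatFlow : flow.IsConjugateHeatFlow I' μ
  /-- `supp μ_t = 𝒳_t`. -/
  isOpenPosMeasure : ∀ t : I', (μ t).IsOpenPosMeasure

namespace MetricFlowPair

variable {I : Set ℝ}

/-- Each `μ_t` is a probability measure (part of being a conjugate heat flow over `I'`).
[cite: Bamler2023, §5.1, Definition (metric flow pairs and isometries)] -/
theorem isProbabilityMeasure_μ (P : MetricFlowPair I) (t : P.I') : IsProbabilityMeasure (P.μ t) :=
  P.isConjugateHeatFlow.1 t t.2

/-- **Fully defined over `J`**: `J ⊆ I'` (Bamler 2023, §5.1: "If `J ⊂ I'`, then we say that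
`(𝒳, (μ_t)_{t ∈ I})` is fully defined over `J`"). [cite: Bamler2023, §5.1, Definition (metric flow pairs and isometries)] -/
def FullyDefinedOver (P : MetricFlowPair I) (J : Set ℝ) : Prop :=
  J ⊆ P.I'

end MetricFlowPair

/-! ### Correspondences between two metric flows -/

namespace MetricFlow

/-- **Correspondence between two metric flows `𝒳¹` (over `I¹`) and `𝒳²` (over `I²`) over
`I'' ⊆ ℝ`** (Bamler 2023, §5.1, Definition (Correspondence), the case `ℐ = {1, 2}`): comparison
metric spaces `(Z_t, d^Z_t)`, `t ∈ I''` (with their Borel σ-algebras), domains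
`I''^{,i} ⊆ I^i ∩ I''`, and isometric embeddings `φ^i_t : 𝒳^i_t → Z_t` for `t ∈ I''^{,i}`.
[cite: Bamler2023, §5.1, Definition (Correspondence)] -/
structure Correspondence₂ {I₁ I₂ : Set ℝ} (𝒳₁ : MetricFlow.{u} I₁) (𝒳₂ : MetricFlow.{u} I₂)
    (I'' : Set ℝ) : Type (u + 1) where
  /-- The comparison space `Z_t`, `t ∈ I''`. -/
  Z : I'' → Type u
  /-- `(Z_t, d^Z_t)` is a metric space … -/
  [instMetricSpace : ∀ t, MetricSpace (Z t)]
  /-- … with a σ-algebra … -/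
  [instMeasurableSpace : ∀ t, MeasurableSpace (Z t)]
  /-- … equal to its Borel σ-algebra. -/
  [instBorelSpace : ∀ t, BorelSpace (Z t)]
  /-- The domain `I''^{,1}` of the first family of embeddings. -/
  dom₁ : Set ℝ
  /-- The domain `I''^{,2}` of the second family of embeddings. -/
  dom₂ : Set ℝ
  /-- `I''^{,1} ⊆ I¹ ∩ I''`. -/
  dom₁_subset : dom₁ ⊆ I₁ ∩ I''
  /-- `I''^{,2} ⊆ I² ∩ I''`. -/
  dom₂_subset : dom₂ ⊆ I₂ ∩ I''
  /-- The embeddings `φ¹_t : 𝒳¹_t → Z_t`, `t ∈ I''^{,1}`. -/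
  φ₁ : ∀ (t : ℝ) (ht : t ∈ dom₁), 𝒳₁.Slice ⟨t, (dom₁_subset ht).1⟩ → Z ⟨t, (dom₁_subset ht).2⟩
  /-- The embeddings `φ²_t : 𝒳²_t → Z_t`, `t ∈ I''^{,2}`. -/
  φ₂ : ∀ (t : ℝ) (ht : t ∈ dom₂), 𝒳₂.Slice ⟨t, (dom₂_subset ht).1⟩ → Z ⟨t, (dom₂_subset ht).2⟩
  /-- `φ¹_t` is an isometric embedding. -/
  isometry₁ : ∀ t ht, Isometry (φ₁ t ht)
  /-- `φ²_t` is an isometric embedding. -/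
  isometry₂ : ∀ t ht, Isometry (φ₂ t ht)

attribute [instance] Correspondence₂.instMetricSpace Correspondence₂.instMeasurableSpace
  Correspondence₂.instBorelSpace

namespace Correspondence₂

variable {I₁ I₂ : Set ℝ} {𝒳₁ : MetricFlow.{u} I₁} {𝒳₂ : MetricFlow.{u} I₂} {I'' : Set ℝ}

/-- **`ℭ` is fully defined over `J`**: `J ⊆ I''^{,i}` for `i = 1, 2` (Bamler 2023, §5.1).
[cite: Bamler2023, §5.1, Definition (Correspondence)] -/
def FullyDefinedOver (ℭ : Correspondence₂ 𝒳₁ 𝒳₂ I'') (J : Set ℝ) : Prop :=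
  J ⊆ ℭ.dom₁ ∧ J ⊆ ℭ.dom₂

/-- The domains of a correspondence lie in `I''`. [cite: Bamler2023, §5.1, Definition (Correspondence)] -/
theorem dom₁_subset_right (ℭ : Correspondence₂ 𝒳₁ 𝒳₂ I'') : ℭ.dom₁ ⊆ I'' :=
  fun _ ht ↦ (ℭ.dom₁_subset ht).2

/-- The domains of a correspondence lie in the time-sets of the flows. [cite: Bamler2023, §5.1, Definition (Correspondence)] -/
theorem dom₁_subset_left (ℭ : Correspondence₂ 𝒳₁ 𝒳₂ I'') : ℭ.dom₁ ⊆ I₁ :=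
  fun _ ht ↦ (ℭ.dom₁_subset ht).1

end Correspondence₂

end MetricFlow

/-! ### The `𝔽`-distance -/

namespace MetricFlowPair

open MetricFlow

variable {I₁ I₂ : Set ℝ}

/-- The integrand of condition (2) of the `𝔽`-distance within a correspondence: for `s ≤ t` in
`I''^{,1} ∩ I''^{,2}` and `(x¹, x²) ∈ 𝒳¹_t × 𝒳²_t`, the Wasserstein distance in `Z_s` of the pushed
forward conjugate heat kernels, `d_{W₁}^{Z_s}((φ¹_s)_* ν¹_{x¹;s}, (φ²_s)_* ν²_{x²;s})`.
[cite: Bamler2023, §5.1, Definition (F-distance within correspondence)] -/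
def kernelDistWithin (P₁ : MetricFlowPair.{u} I₁) (P₂ : MetricFlowPair.{u} I₂) {I'' : Set ℝ}
    (ℭ : Correspondence₂ P₁.flow P₂.flow I'') {s t : ℝ} (hs₁ : s ∈ ℭ.dom₁) (hs₂ : s ∈ ℭ.dom₂)
    (ht₁ : t ∈ ℭ.dom₁) (ht₂ : t ∈ ℭ.dom₂)
    (p : P₁.flow.Slice ⟨t, (ℭ.dom₁_subset ht₁).1⟩ × P₂.flow.Slice ⟨t, (ℭ.dom₂_subset ht₂).1⟩) :
    ℝ≥0∞ :=
  wassersteinW1 (X := ℭ.Z ⟨s, (ℭ.dom₁_subset hs₁).2⟩)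
    ((P₁.flow.condKernel p.1 ⟨s, (ℭ.dom₁_subset hs₁).1⟩).map (ℭ.φ₁ s hs₁))
    ((P₂.flow.condKernel p.2 ⟨s, (ℭ.dom₂_subset hs₂).1⟩).map (ℭ.φ₂ s hs₂))

/-- **Admissible radii for `d_𝔽^{ℭ,J}`** (the property quantified in Bamler 2023, §5.1, Definition
(`𝔽`-distance within correspondence)): `r > 0` is admissible if there are a measurable `E ⊆ I''` with
`J ⊆ I'' ∖ E ⊆ I''^{,1} ∩ I''^{,2}` and `|E| ≤ r²`, and couplings `q_t` between `μ¹_t, μ²_t` for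
`t ∈ I'' ∖ E`, such that for all `s ≤ t` in `I'' ∖ E`,
`∫ d_{W₁}^{Z_s}((φ¹_s)_* ν¹_{x¹;s}, (φ²_s)_* ν²_{x²;s}) dq_t(x¹, x²) ≤ r`.
[cite: Bamler2023, §5.1, Definition (F-distance within correspondence)] -/
def FDistAdmissible (P₁ : MetricFlowPair.{u} I₁) (P₂ : MetricFlowPair.{u} I₂) {I'' : Set ℝ}
    (ℭ : Correspondence₂ P₁.flow P₂.flow I'') (J : Set ℝ) (r : ℝ) : Prop :=
  0 < r ∧ ∃ (E : Set ℝ) (_ : MeasurableSet E) (_ : E ⊆ I'') (_ : J ⊆ I'' \ E)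
    (hE₁ : I'' \ E ⊆ ℭ.dom₁) (hE₂ : I'' \ E ⊆ ℭ.dom₂) (_ : volume E ≤ ENNReal.ofReal (r ^ 2))
    (q : ∀ t (ht : t ∈ I'' \ E),
      Measure (P₁.flow.Slice ⟨t, (ℭ.dom₁_subset (hE₁ ht)).1⟩ ×
        P₂.flow.Slice ⟨t, (ℭ.dom₂_subset (hE₂ ht)).1⟩)),
    (∀ t (ht : t ∈ I'' \ E),
      IsCoupling (P₁.μ ⟨t, (ℭ.dom₁_subset (hE₁ ht)).1⟩) (P₂.μ ⟨t, (ℭ.dom₂_subset (hE₂ ht)).1⟩)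
        (q t ht)) ∧
    ∀ s (hs : s ∈ I'' \ E) t (ht : t ∈ I'' \ E), s ≤ t →
      ∫⁻ p, kernelDistWithin P₁ P₂ ℭ (hE₁ hs) (hE₂ hs) (hE₁ ht) (hE₂ ht) p ∂(q t ht) ≤
        ENNReal.ofReal r

variable {P₁ : MetricFlowPair.{u} I₁} {P₂ : MetricFlowPair.{u} I₂} {I'' : Set ℝ}
  {ℭ : Correspondence₂ P₁.flow P₂.flow I''} {J : Set ℝ}

/-- Admissibility is an up-set in `r`: the same `E` and couplings witness every larger radius
(`|E| ≤ r² ≤ r'²`, and the integrals are `≤ r ≤ r'`). [cite: Bamler2023, §5.1, Definition (F-distance within correspondence)] -/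
theorem FDistAdmissible.mono {r r' : ℝ} (h : FDistAdmissible P₁ P₂ ℭ J r) (hrr' : r ≤ r') :
    FDistAdmissible P₁ P₂ ℭ J r' := by
  obtain ⟨hr, E, hEm, hEI, hJ, hE₁, hE₂, hvol, q, hq, hint⟩ := h
  have hr' : 0 < r' := hr.trans_le hrr'
  refine ⟨hr', E, hEm, hEI, hJ, hE₁, hE₂, hvol.trans ?_, q, hq, fun s hs t ht hst ↦
    (hint s hs t ht hst).trans (ENNReal.ofReal_le_ofReal hrr')⟩
  exact ENNReal.ofReal_le_ofReal (pow_le_pow_left₀ hr.le hrr' 2)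

/-- **The `𝔽`-distance within a correspondence `ℭ`, uniform over `J`** (Bamler 2023, §5.1,
Definition (`𝔽`-distance within correspondence)):
`d_𝔽^{ℭ,J}((𝒳¹, (μ¹_t)), (𝒳², (μ²_t))) = inf {r > 0 admissible}` (`FDistAdmissible`), valued in
`[0, ∞]` ("we allow `d_𝔽^{ℭ,J}` to attain the value `∞`": the infimum of the empty family is `∞`).
`J = ∅` gives `d_𝔽^ℭ`. [cite: Bamler2023, §5.1, Definition (F-distance within correspondence)] -/
def fDistWithin (P₁ : MetricFlowPair.{u} I₁) (P₂ : MetricFlowPair.{u} I₂) {I'' : Set ℝ}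
    (ℭ : Correspondence₂ P₁.flow P₂.flow I'') (J : Set ℝ) : ℝ≥0∞ :=
  ⨅ (r : ℝ) (_ : FDistAdmissible P₁ P₂ ℭ J r), ENNReal.ofReal r

/-- Every admissible radius bounds `d_𝔽^{ℭ,J}`. [cite: Bamler2023, §5.1, Definition (F-distance within correspondence)] -/
theorem fDistWithin_le {r : ℝ} (h : FDistAdmissible P₁ P₂ ℭ J r) :
    fDistWithin P₁ P₂ ℭ J ≤ ENNReal.ofReal r :=
  iInf₂_le r h

/-- `d_𝔽^{ℭ,J}` is characterised from below: `a ≤ d_𝔽^{ℭ,J}` iff `a ≤ r` for every admissible `r`.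
[cite: Bamler2023, §5.1, Definition (F-distance within correspondence)] -/
theorem le_fDistWithin_iff {a : ℝ≥0∞} :
    a ≤ fDistWithin P₁ P₂ ℭ J ↔ ∀ r : ℝ, FDistAdmissible P₁ P₂ ℭ J r → a ≤ ENNReal.ofReal r := by
  simp only [fDistWithin, le_iInf_iff]

/-- **The `𝔽`-distance, uniform over `J`** between two metric flow pairs over a common `I`
(Bamler 2023, §5.1, Definition (`𝔽`-distance)): the infimum of `d_𝔽^{ℭ,J}` over all
correspondences `ℭ` between `𝒳¹, 𝒳²` over `I` (`I'' = I`) that are fully defined over `J`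
(comparison spaces `Z_t` ranging over types in the universe of the flows). `J = ∅` gives `d_𝔽`,
`J = {t₀}` gives `d_𝔽^{t₀}`. [cite: Bamler2023, §5.1, Definition (F-distance)] -/
def fDist {I : Set ℝ} (J : Set ℝ) (P₁ P₂ : MetricFlowPair.{u} I) : ℝ≥0∞ :=
  ⨅ (ℭ : Correspondence₂ P₁.flow P₂.flow I) (_ : ℭ.FullyDefinedOver J), fDistWithin P₁ P₂ ℭ J

/-- Every correspondence over `I` fully defined over `J` bounds `d_𝔽^J` by its `d_𝔽^{ℭ,J}`.
[cite: Bamler2023, §5.1, Definition (F-distance)] -/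
theorem fDist_le_fDistWithin {I : Set ℝ} {J : Set ℝ} {P₁ P₂ : MetricFlowPair.{u} I}
    (ℭ : Correspondence₂ P₁.flow P₂.flow I) (hℭ : ℭ.FullyDefinedOver J) :
    fDist J P₁ P₂ ≤ fDistWithin P₁ P₂ ℭ J :=
  iInf₂_le ℭ hℭ

end MetricFlowPair

end Literature.Geometry.Riemannian

end
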